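import Literature.IUT.HodgeTheaters.GoodLocalFrobenioidDashSigmaLift
import Literature.IUT.HodgeTheaters.GenuineFKitMergeInputsLiftsAllTransporters
import Literature.IUT.HodgeTheaters.Cor53iiAtGoodPlaceOfBaseIso
import Literature.AnabelianGeometry.SemiGraphs.CosetCategoriesEquivalencePull
import HarnessLib

/-!
# [IUTchI] Cor 5.3 (iii) at the GENUINE good nonarchimedean `⊢`-carrier: EVERY topological automorphism of `G_v̲ = Gal(K̄_v̲/K_v̲)` lifts to
# an automorphism of the split Frobenioid `ℱ⊢_v̲ = (𝒞⊢_v̲, τ⊢_v̲)` — the mono-analytic surjectivity «from [AbsTopIII] Prop 5.8 (ii)», as a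
# THEOREM for abc-iut-L5-t2's construction at every MLF, at the place data, and at the merge term (abc-iut-L5-t16, row R77 (c), PROOF-ONLY)

S. Mochizuki, *Inter-universal Teichmüller theory I*, kurims manuscript (May 2020), §5 Corollary 5.3 (iii) p. 144 («For `i = 1, 2`, let `ⁱ𝔉⊢` be an
`ℱ⊢`-prime-strip; `ⁱ𝔇⊢` the `𝒟⊢`-prime-strip associated to `ⁱ𝔉⊢` [cf. Remark 5.2.1, (i)]. Then the natural map `Isom(¹𝔉⊢, ²𝔉⊢) → Isom(¹𝔇⊢, ²𝔇⊢)`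
[cf. Remark 5.2.1, (i)] is surjective»; proof p. 144: (iii) «follows immediately from […] [AbsTopIII], Proposition 5.8, (ii), (v)»), §3 Example 3.3 (i)
p. 78 («Write `ℱ⊢_v := (𝒞⊢_v, τ⊢_v)` for the resulting split Frobenioid»), Def 5.2 (ii) p. 134 («if `v ∈ 𝕍^non`, then `‡ℱ⊢_v` is a split Frobenioid,
whose underlying Frobenioid we denote by `‡𝒞⊢_v`, which admits an isomorphism `‡ℱ⊢_v ⥲ ℱ⊢_v`») ([IUTchI] Cor 5.3 (iii) p.144)
[claim: Mochizuki2012, status: disputed] (D-0012 claim key; PROOFS over landed files; nothing of the series is asserted; no side is taken on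
[IUTchIII] Cor. 3.12).  S. Mochizuki, *Topics in absolute anabelian geometry I*, Prop. 1.2.1 (iii), (iv), (vi) pp. 10–11 — in tree as abc-iut-L4-d3's
`Prop121vii.unitsTransport_holds` / abc-iut-w4-d047's `MLFSigma.sigma` [cite: MochizukiAbsAnab2004, Prop 1.2.1 (vi) p.10].

## What this file proves (cell abc-iut, L5 HUB node `IUTchI:Cor5.3(iii)` — the GOOD NONARCHIMEDEAN `⊢`-SLOT, faithfulness spec of record
## «surjective AS PRINTED», abc-iut-L5-lead RULINGS #143 (2); 0 def · 0 instance · 0 notation · no `Prop` fact)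

abc-iut-L5-t16's `DashSigmaLift` (R77 (b)) lifts `(β, σ)` to a `τ⊢`-preserving self-equivalence of `𝒞⊢_v̲` lying over `pull β`, for ANY multiplicative
`σ : K̄_v̲ˣ ⥲ K̄_v̲ˣ` that is `β⁻¹`-equivariant, integral with integral inverse, and of the same valuation at `p`.  HERE every such binder is DISCHARGED
for EVERY topological automorphism `β` of `G_v̲`, from the tree's anabelian kernel theorems only (`k` complete nonarchimedean, finite over `ℚ_p`;
`k̄` with abc-iut-L5-t16's spectral-norm valuation `(ofComplete p k).valΩ`):
* §A `valuation_sigma_le_one` (`σ_α := MLFSigma.sigma k α` is integral, abc-iut-L6-t13 `Prop121vii.isAbsInteger_iff_of_unitsTransport`),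
  **`valuation_sigma_eq_of_coe_eq_p`** (`v(σ_α p) = v(p)`: `p^m = π^n u ⇒ σ(p)^m = π'^n σ(u)`, abc-iut-L6-t13 `isAbsInteger_iff_exists_pow_eq`);
* §B **`exists_dashLift`** — for EVERY `β : Gal(k̄/k) ≃ₜ* Gal(k̄/k)`: a self-equivalence `Ψ` of `𝒞⊢_v̲ = (Datum.prim (ofComplete p k).fieldFunctor …).frobenioid`
  LYING UNDER `pullSelfEquiv β β⁻¹` AND carrying `τ_p(A)` onto `τ_p(Ψ A)` for every `A` (σ := `σ_{β⁻¹}`, σ' := `σ_β`); `liesOverClass_dashLift`; and IN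
  FULL **`exists_dashLift_of_equivalence`** — EVERY self-equivalence `E` of `𝒟⊢_v̲` has a `τ⊢`-preserving self-equivalence of `𝒞⊢_v̲` lying under it
  (`E ≅ pull β⁻¹`, abc-iut-L1 `CosetCat.exists_continuousMulEquiv_nonempty_iso_pull` = [SemiAnbd] Prop 3.2 at the profinite Galois-countable `Gal(k̄/k)`);
* §C the same AT abc-iut-L5-t2's place record `D.goodLocalFrobenioidOfEmb p k ι hX` (`exists_dashLift_ofEmb`, `…_ofEmb_of_equivalence`), §D AT THE
  MERGE TERM, racer C's `D.frobeniusGoodAt CG hA B I x hx` (`exists_dashLift_frobeniusGoodAt`, **`…_frobeniusGoodAt_of_equivalence`**);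
* §E (v2, APPEND-ONLY rider) `valuation_sigma_eq_of_le_one` / **`valuation_sigma_eq`** — `σ_α` preserves the valuation of EVERY `x ∈ k̄ˣ` (the
  «same valuation at the constant section» binder of every sibling `⊢`-slot, e.g. abc-iut-L5-t4's bad datum `c = q̲_v̲`, in one stroke).
CENSUS (#110 (4) grammar): binders {p, k (resp. place data / the kit's ∪ {I, x, hx}), β or E} · LAW ∅ · FACT ∅ · side ∅ · DATA ∅ — every anabelian
input enters by IMPORT of kernel theorems.  NOT claimed: injectivity/rigidity (print's (iii) is surjectivity only), the archimedean and bad `⊢`-slots.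
HONEST FRAMING: a lift over OUR carrier is OUR theorem; typed ≠ proved beyond what is here; nothing here asserts abc proved or refuted.
-/

noncomputable section

namespace Literature.IUT.HodgeTheaters

open CategoryTheory Opposite Literature.AnabelianGeometry.SemiGraphs Literature.AlgebraicGeometry.Frobenioids
open Literature.AnabelianGeometry.AbsoluteAnabelian Literature.NumberTheory.GaloisRepresentations
open scoped ValuativeRel

namespace Cor53iii

/-! ### §A. The anabelian `σ_α` is integral and preserves the valuation of `p` (MLF currency) -/

section MLF

variable (p : ℕ) [Fact p.Prime] (k : Type) [NontriviallyNormedField k] [CompleteSpace k] [IsUltrametricDist k]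
  [NormedAlgebra ℚ_[p] k] [FiniteDimensional ℚ_[p] k]

/-- **`σ_α` is INTEGRAL** for abc-iut-L5-t16's spectral-norm valuation of `k̄`: `v(x) ≤ 1 → v(σ_α x) ≤ 1` (abc-iut-L6-t13
`Prop121vii.isAbsInteger_iff_of_unitsTransport` from `MLFSigma.preservesAbsUnits_/preservesUniformizers_sigma`, through abc-iut-w4-d047's
dictionary `valuation_closure_le_one_iff_mem_absIntegers`). [cite: MochizukiAbsAnab2004, Prop 1.2.1 (iii) p.10] -/
theorem valuation_sigma_le_one (α : Field.absoluteGaloisGroup k ≃ₜ* Field.absoluteGaloisGroup k) (x : (AlgebraicClosure k)ˣ)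
    (hx : @ValuativeRel.valuation (AlgebraicClosure k) _ (GaloisValDatum.ofComplete p k).valΩ (x : AlgebraicClosure k) ≤ 1) :
    letI := GaloisValDatum.normVal k
    haveI := GoodPlaceSigma.isNonarchimedeanLocalField p k
    haveI : CharZero k := GaloisValDatum.charZero p k
    @ValuativeRel.valuation (AlgebraicClosure k) _ (GaloisValDatum.ofComplete p k).valΩ (MLFSigma.sigma k α x : AlgebraicClosure k) ≤ 1 := by
  letI := GaloisValDatum.normVal k
  haveI := GoodPlaceSigma.isNonarchimedeanLocalField p k
  haveI : CharZero k := GaloisValDatum.charZero p k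
  rw [valuation_closure_le_one_iff_mem_absIntegers] at hx ⊢
  exact (Prop121vii.isAbsInteger_iff_of_unitsTransport (MLFSigma.preservesAbsUnits_sigma k α) (MLFSigma.preservesUniformizers_sigma k α) x).mp hx

/-- An absolute unit of `k̄` (both `u` and `u⁻¹` integral over `𝒪_k`) has spectral-norm valuation `1`. [cite: NeukirchANT1999, Ch. II (4.8)] -/
theorem valuation_eq_one_of_absUnit (u : (AlgebraicClosure k)ˣ)
    (hu : (letI := GaloisValDatum.normVal k; (u : AlgebraicClosure k) ∈ absIntegers 𝒪[k] k ∧ (↑u⁻¹ : AlgebraicClosure k) ∈ absIntegers 𝒪[k] k)) :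
    @ValuativeRel.valuation (AlgebraicClosure k) _ (GaloisValDatum.ofComplete p k).valΩ (u : AlgebraicClosure k) = 1 := by
  letI := GaloisValDatum.normVal k
  letI : ValuativeRel (AlgebraicClosure k) := (GaloisValDatum.ofComplete p k).valΩ
  have h1 : ValuativeRel.valuation (AlgebraicClosure k) (u : AlgebraicClosure k) ≤ 1 :=
    (valuation_closure_le_one_iff_mem_absIntegers p k (u : AlgebraicClosure k)).mpr hu.1
  have h2 : ValuativeRel.valuation (AlgebraicClosure k) ((u⁻¹ : (AlgebraicClosure k)ˣ) : AlgebraicClosure k) ≤ 1 :=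
    (valuation_closure_le_one_iff_mem_absIntegers p k _).mpr hu.2
  rw [Units.val_inv_eq_inv_val, map_inv₀, inv_le_one₀ (zero_lt_iff.mpr ((Valuation.ne_zero_iff _).mpr u.ne_zero))] at h2
  exact le_antisymm h1 h2

/-- **`σ_α` PRESERVES THE VALUATION OF `p`**: for `x = p ∈ k̄ˣ`, `v(σ_α x) = v(p)` — `p^m = π^n · u` with `π` a uniformiser of `k` and `u` an absolute unit
(abc-iut-L6-t13 `isAbsInteger_iff_exists_pow_eq`), so `σ_α(p)^m = π'^n · σ_α(u)` with `π'` again a uniformiser of `k` (`PreservesUniformizers`) and `σ_α(u)` an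
absolute unit (`PreservesAbsUnits`); valuations of uniformisers of `k` agree, and `m`-th powers are injective in the value group.  (`σ_α p ≠ p` in general —
hence the `p`-normalisation of abc-iut-L5-t16's brick.) [cite: MochizukiAbsAnab2004, Prop 1.2.1 (iv) p.10] -/
theorem valuation_sigma_eq_of_coe_eq_p (α : Field.absoluteGaloisGroup k ≃ₜ* Field.absoluteGaloisGroup k) (x : (AlgebraicClosure k)ˣ)
    (hx : (x : AlgebraicClosure k) = (p : ℕ)) :
    letI := GaloisValDatum.normVal k
    haveI := GoodPlaceSigma.isNonarchimedeanLocalField p k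
    haveI : CharZero k := GaloisValDatum.charZero p k
    @ValuativeRel.valuation (AlgebraicClosure k) _ (GaloisValDatum.ofComplete p k).valΩ (MLFSigma.sigma k α x : AlgebraicClosure k) =
      @ValuativeRel.valuation (AlgebraicClosure k) _ (GaloisValDatum.ofComplete p k).valΩ ((p : ℕ) : AlgebraicClosure k) := by
  letI := GaloisValDatum.normVal k
  haveI := GoodPlaceSigma.isNonarchimedeanLocalField p k
  haveI : CharZero k := GaloisValDatum.charZero p k
  letI : ValuativeRel (AlgebraicClosure k) := (GaloisValDatum.ofComplete p k).valΩ
  haveI : ValuativeExtension k (AlgebraicClosure k) := (GaloisValDatum.ofComplete p k).valExt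
  obtain ⟨π, hπ⟩ := exists_isUniformizer k
  obtain ⟨π₂, hπ₂, hσπ⟩ := MLFSigma.preservesUniformizers_sigma k α π hπ
  have hU := MLFSigma.preservesAbsUnits_sigma k α
  -- `p` is integral, hence `p^m = π^n · u`
  have hp1 : ValuativeRel.valuation (AlgebraicClosure k) ((p : ℕ) : AlgebraicClosure k) ≤ 1 := by
    rw [← (ValuativeRel.valuation (AlgebraicClosure k)).map_one, ← Valuation.Compatible.vle_iff_le]
    exact (GaloisValDatum.ofComplete p k).p_vle_one_Ω.1
  have hxint : (x : AlgebraicClosure k) ∈ absIntegers 𝒪[k] k :=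
    (valuation_closure_le_one_iff_mem_absIntegers p k (x : AlgebraicClosure k)).mp (by rw [hx]; exact hp1)
  obtain ⟨m, n, hm, u, hu, hxu⟩ := (Prop121vii.isAbsInteger_iff_exists_pow_eq k π hπ x).mp hxint
  have hσxu : MLFSigma.sigma k α x ^ m =
      Units.map (algebraMap k (AlgebraicClosure k) : k →* AlgebraicClosure k) π₂ ^ n * MLFSigma.sigma k α u := by
    rw [← map_pow, hxu, map_mul, map_pow, hσπ]
  -- the valuations of the factors
  have hvπ : ValuativeRel.valuation (AlgebraicClosure k) ((Units.map (algebraMap k (AlgebraicClosure k) : k →* AlgebraicClosure k) π₂ : (AlgebraicClosure k)ˣ) : AlgebraicClosure k) =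
      ValuativeRel.valuation (AlgebraicClosure k) ((Units.map (algebraMap k (AlgebraicClosure k) : k →* AlgebraicClosure k) π : (AlgebraicClosure k)ˣ) : AlgebraicClosure k) := by
    have e : ValuativeRel.valuation k (π₂ : k) = ValuativeRel.valuation k (π : k) := hπ₂.trans hπ.symm
    rw [Units.coe_map, Units.coe_map, MonoidHom.coe_coe, le_antisymm_iff, ← Valuation.Compatible.vle_iff_le, ← Valuation.Compatible.vle_iff_le,
      ValuativeExtension.vle_iff_vle, ValuativeExtension.vle_iff_vle, Valuation.Compatible.vle_iff_le (v := ValuativeRel.valuation k),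
      Valuation.Compatible.vle_iff_le (v := ValuativeRel.valuation k), ← le_antisymm_iff, e]
  have hvu : ValuativeRel.valuation (AlgebraicClosure k) (u : AlgebraicClosure k) = 1 := valuation_eq_one_of_absUnit p k u hu
  have hvσu : ValuativeRel.valuation (AlgebraicClosure k) (MLFSigma.sigma k α u : AlgebraicClosure k) = 1 :=
    valuation_eq_one_of_absUnit p k _ ((hU u).mp hu)
  -- compare `m`-th powers
  have h1 : ValuativeRel.valuation (AlgebraicClosure k) (MLFSigma.sigma k α x : AlgebraicClosure k) ^ m =
      ValuativeRel.valuation (AlgebraicClosure k) ((Units.map (algebraMap k (AlgebraicClosure k) : k →* AlgebraicClosure k) π : (AlgebraicClosure k)ˣ) : AlgebraicClosure k) ^ n := by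
    rw [← map_pow, ← Units.val_pow_eq_pow_val, hσxu, Units.val_mul, Units.val_pow_eq_pow_val, map_mul, map_pow, hvσu, mul_one, hvπ]
  have h2 : ValuativeRel.valuation (AlgebraicClosure k) (x : AlgebraicClosure k) ^ m =
      ValuativeRel.valuation (AlgebraicClosure k) ((Units.map (algebraMap k (AlgebraicClosure k) : k →* AlgebraicClosure k) π : (AlgebraicClosure k)ˣ) : AlgebraicClosure k) ^ n := by
    rw [← map_pow, ← Units.val_pow_eq_pow_val, hxu, Units.val_mul, Units.val_pow_eq_pow_val, map_mul, map_pow, hvu, mul_one]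
  rw [← hx]
  exact (pow_left_inj₀ zero_le zero_le hm.ne').mp (h1.trans h2.symm)

end MLF

/-! ### §B. EVERY topological automorphism of `G_v̲` lifts to a `τ⊢`-preserving self-equivalence of `𝒞⊢_v̲` -/

section GalAux

variable (k : Type) [Field k] (β : Field.absoluteGaloisGroup k ≃ₜ* Field.absoluteGaloisGroup k)

/-- `β ∘ β⁻¹ = id` on `Gal(k̄/k)`, as monoid homomorphisms. [folklore] -/
private theorem toMonoidHom_comp_symm :
    ((β : Field.absoluteGaloisGroup k ≃* Field.absoluteGaloisGroup k) : Field.absoluteGaloisGroup k →* Field.absoluteGaloisGroup k).comp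
        ((β : Field.absoluteGaloisGroup k ≃* Field.absoluteGaloisGroup k).symm : Field.absoluteGaloisGroup k →* Field.absoluteGaloisGroup k) =
      MonoidHom.id _ :=
  MonoidHom.ext (β : Field.absoluteGaloisGroup k ≃* Field.absoluteGaloisGroup k).apply_symm_apply

/-- `β⁻¹ ∘ β = id` on `Gal(k̄/k)`, as monoid homomorphisms. [folklore] -/
private theorem symm_comp_toMonoidHom :
    ((β : Field.absoluteGaloisGroup k ≃* Field.absoluteGaloisGroup k).symm : Field.absoluteGaloisGroup k →* Field.absoluteGaloisGroup k).comp
        ((β : Field.absoluteGaloisGroup k ≃* Field.absoluteGaloisGroup k) : Field.absoluteGaloisGroup k →* Field.absoluteGaloisGroup k) =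
      MonoidHom.id _ :=
  MonoidHom.ext (β : Field.absoluteGaloisGroup k ≃* Field.absoluteGaloisGroup k).symm_apply_apply

end GalAux

section Lift

variable (p : ℕ) [Fact p.Prime] (k : Type) [NontriviallyNormedField k] [CompleteSpace k] [IsUltrametricDist k]
  [NormedAlgebra ℚ_[p] k] [FiniteDimensional ℚ_[p] k] (β : Field.absoluteGaloisGroup k ≃ₜ* Field.absoluteGaloisGroup k)

/-- **[IUTchI] Cor 5.3 (iii) AT THE GENUINE GOOD `⊢`-CARRIER OF AN MLF — EVERY `β ∈ Aut(G_v̲)` LIFTS.**  For every isomorphism of topological groups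
`β : Gal(k̄/k) ⥲ Gal(k̄/k)` there is a self-equivalence `Ψ` of `𝒞⊢_v̲ := (Datum.prim (ofComplete p k).fieldFunctor …).frobenioid` (abc-iut-L5-t2's REAL
`𝒞⊢_v̲` over `𝒟⊢_v̲ = CosetCat Gal(k̄/k)`) LYING UNDER the transport `pullSelfEquiv β β⁻¹` of `𝒟⊢_v̲` through `𝒞⊢_v̲ → 𝒟⊢_v̲`, AND carrying the characteristic
splitting `τ_p(A)` onto `τ_p(Ψ A)` for every object `A` — an automorphism of the split Frobenioid `ℱ⊢_v̲ = (𝒞⊢_v̲, τ⊢_v̲)` over `β`: the printed surjectivity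
of `Isom(ℱ⊢_v̲) → Isom(𝒟⊢_v̲)` onto the class of `β` ([AbsTopIII] Prop 5.8 (ii) route, via `σ_{β⁻¹}` / `σ_β`).
([IUTchI] Cor 5.3 (iii) p.144) [claim: Mochizuki2012, status: disputed] -/
theorem exists_dashLift :
    ∃ Ψ : (DashSigmaLift.primDatum (GaloisValDatum.ofComplete p k)).frobenioid ≌ (DashSigmaLift.primDatum (GaloisValDatum.ofComplete p k)).frobenioid,
      Nonempty (CatIsomorphism.LiesUnder
        (ModelFrobenioid.baseFunctor _ _ (DashSigmaLift.primDatum (GaloisValDatum.ofComplete p k)).divB)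
        (ModelFrobenioid.baseFunctor _ _ (DashSigmaLift.primDatum (GaloisValDatum.ofComplete p k)).divB) Ψ
        (PiTransport.pullSelfEquiv _ _ β.continuous β.symm.continuous (toMonoidHom_comp_symm k β) (symm_comp_toMonoidHom k β))) ∧
      ∀ X, ((DashSigmaLift.primDatum (GaloisValDatum.ofComplete p k)).pSplittingSubmonoid X).map (Ψ.functor.mapEnd X) =
        (DashSigmaLift.primDatum (GaloisValDatum.ofComplete p k)).pSplittingSubmonoid (Ψ.functor.obj X) := by
  letI := GaloisValDatum.normVal k
  haveI := GoodPlaceSigma.isNonarchimedeanLocalField p k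
  haveI : CharZero k := GaloisValDatum.charZero p k
  -- `β` read on `(ofComplete p k).Gal = Gal(k̄/k)`
  let βm : (AlgebraicClosure k ≃ₐ[k] AlgebraicClosure k) ≃* (AlgebraicClosure k ≃ₐ[k] AlgebraicClosure k) :=
    (β : Field.absoluteGaloisGroup k ≃* Field.absoluteGaloisGroup k)
  have hβc : Continuous βm := β.continuous
  have hβc' : Continuous βm.symm := β.symm.continuous
  -- the anabelian σ's: `σ := σ_{β⁻¹}` is `β⁻¹`-equivariant, `σ' := σ_β` is `β`-equivariant, mutually inverse, both integral, both fix `v(p)`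
  let σ : (AlgebraicClosure k)ˣ →* (AlgebraicClosure k)ˣ := (MLFSigma.sigma k β.symm).toMonoidHom
  let σ' : (AlgebraicClosure k)ˣ →* (AlgebraicClosure k)ˣ := (MLFSigma.sigma k β).toMonoidHom
  have hσ : ∀ (γ : AlgebraicClosure k ≃ₐ[k] AlgebraicClosure k) (y : (AlgebraicClosure k)ˣ), σ (γ • y) = βm.symm γ • σ y :=
    fun γ y => MLFSigma.sigma_smul k β.symm γ y
  have hσ' : ∀ (γ : AlgebraicClosure k ≃ₐ[k] AlgebraicClosure k) (y : (AlgebraicClosure k)ˣ), σ' (γ • y) = βm γ • σ' y :=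
    fun γ y => MLFSigma.sigma_smul k β γ y
  have hinv : ∀ y, σ' (σ y) = y := fun y => by
    change MLFSigma.sigma k β (MLFSigma.sigma k β.symm y) = y
    rw [MLFSigma.sigma_symm, MulEquiv.apply_symm_apply]
  have hinv' : ∀ y, σ (σ' y) = y := fun y => by
    change MLFSigma.sigma k β.symm (MLFSigma.sigma k β y) = y
    rw [MLFSigma.sigma_symm, MulEquiv.symm_apply_apply]
  obtain ⟨Ψ, hΨ, hlies⟩ := DashSigmaLift.exists_selfEquivalence_liesUnder_pullSelfEquiv (GaloisValDatum.ofComplete p k) βm hβc σ hσ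
    (fun y hy => valuation_sigma_le_one p k β.symm y hy) (fun y hy => valuation_sigma_eq_of_coe_eq_p p k β.symm y hy) hβc' σ' hσ'
    (fun y hy => valuation_sigma_le_one p k β y hy) (fun y hy => valuation_sigma_eq_of_coe_eq_p p k β y hy) hinv hinv'
  refine ⟨Ψ, hlies, fun X => ?_⟩
  rw [hΨ]
  exact DashSigmaLift.map_pSplittingSubmonoid_lift (GaloisValDatum.ofComplete p k) βm hβc σ hσ
    (fun y hy => valuation_sigma_le_one p k β.symm y hy) (fun y hy => valuation_sigma_eq_of_coe_eq_p p k β.symm y hy) hβc' σ' hσ'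
    (fun y hy => valuation_sigma_le_one p k β y hy) (fun y hy => valuation_sigma_eq_of_coe_eq_p p k β y hy) hinv hinv' X

/-- **The §0 reading** ([IUTchI] §0 «isomorphism of categories» = isomorphism class of equivalences; abc-iut-L5-t16 `CatIsomorphism.LiesOverClass`): for
every `β` there is a §0-AUTOMORPHISM `c` of `𝒞⊢_v̲` LYING OVER the §0-automorphism `[pull β]` of `𝒟⊢_v̲` — the class of `β` is in the image of
`Aut(ℱ⊢_v̲) → Aut(𝒟⊢_v̲)`. ([IUTchI] Cor 5.3 (iii) p.144) [claim: Mochizuki2012, status: disputed] -/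
theorem liesOverClass_dashLift :
    ∃ c : CatAut (DashSigmaLift.primDatum (GaloisValDatum.ofComplete p k)).frobenioid,
      CatIsomorphism.LiesOverClass (ModelFrobenioid.baseFunctor _ _ (DashSigmaLift.primDatum (GaloisValDatum.ofComplete p k)).divB) c
        (CatIsomorphism.mk (PiTransport.pullSelfEquiv _ _ β.continuous β.symm.continuous (toMonoidHom_comp_symm k β) (symm_comp_toMonoidHom k β))) := by
  obtain ⟨Ψ, ⟨h⟩, -⟩ := exists_dashLift p k β
  exact ⟨CatIsomorphism.mk Ψ, Ψ, _, rfl, rfl, ⟨h⟩⟩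

/-- **[IUTchI] Cor 5.3 (iii), GOOD `⊢`-SLOT, IN FULL: EVERY self-equivalence of `𝒟⊢_v̲` lifts to an automorphism of `ℱ⊢_v̲`.**  For EVERY equivalence
`E : 𝒟⊢_v̲ ⥲ 𝒟⊢_v̲` of the small coset category of `Gal(k̄/k)` there is a self-equivalence `Ψ` of `𝒞⊢_v̲` LYING UNDER `E` through `𝒞⊢_v̲ → 𝒟⊢_v̲` and carrying
`τ_p(A)` onto `τ_p(Ψ A)` for every `A` — i.e. «the natural map `Isom(¹𝔉⊢, ²𝔉⊢) → Isom(¹𝔇⊢, ²𝔇⊢)` […] is surjective» at `¹𝔉⊢ = ²𝔉⊢ = ℱ⊢_v̲`, the genuine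
good nonarchimedean model.  `E ≅ pull β⁻¹` for a topological automorphism `β` (abc-iut-w4-d058/abc-iut-L1 `CosetCat.exists_continuousMulEquiv_nonempty_iso_pull`,
[SemiAnbd] Prop 3.2, at the profinite Galois-countable `Gal(k̄/k)`: ★ `compactSpace_gal_algebraicClosure`, abc-iut-L1-t7 `secondCountableTopology_gal_ofComplete`),
then `exists_dashLift` and abc-iut-L5-t4's `LiesUnder.ofIsoLower`. ([IUTchI] Cor 5.3 (iii) p.144) [claim: Mochizuki2012, status: disputed] -/
theorem exists_dashLift_of_equivalence
    (E : CosetCat (AlgebraicClosure k ≃ₐ[k] AlgebraicClosure k) ≌ CosetCat (AlgebraicClosure k ≃ₐ[k] AlgebraicClosure k)) :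
    ∃ Ψ : (DashSigmaLift.primDatum (GaloisValDatum.ofComplete p k)).frobenioid ≌ (DashSigmaLift.primDatum (GaloisValDatum.ofComplete p k)).frobenioid,
      Nonempty (CatIsomorphism.LiesUnder
        (ModelFrobenioid.baseFunctor _ _ (DashSigmaLift.primDatum (GaloisValDatum.ofComplete p k)).divB)
        (ModelFrobenioid.baseFunctor _ _ (DashSigmaLift.primDatum (GaloisValDatum.ofComplete p k)).divB) Ψ E) ∧
      ∀ X, ((DashSigmaLift.primDatum (GaloisValDatum.ofComplete p k)).pSplittingSubmonoid X).map (Ψ.functor.mapEnd X) =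
        (DashSigmaLift.primDatum (GaloisValDatum.ofComplete p k)).pSplittingSubmonoid (Ψ.functor.obj X) := by
  haveI := compactSpace_gal_algebraicClosure p k
  haveI : SecondCountableTopology (AlgebraicClosure k ≃ₐ[k] AlgebraicClosure k) := GaloisValDatum.secondCountableTopology_gal_ofComplete p k
  have hG : IsTempered (AlgebraicClosure k ≃ₐ[k] AlgebraicClosure k) := IsTempered.of_profinite
  obtain ⟨φ, hc, hs, ⟨j⟩⟩ := CosetCat.exists_continuousMulEquiv_nonempty_iso_pull hG hG E
  obtain ⟨Ψ, ⟨h⟩, hτ⟩ := exists_dashLift p k φ.symm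
  exact ⟨Ψ, ⟨h.ofIsoLower j.symm⟩, hτ⟩

end Lift

/-! ### §C. At abc-iut-L5-t2's place record `D.goodLocalFrobenioidOfEmb p k ι hX` -/

section PlaceData

variable {F K Fbar : Type} [Field F] [NumberField F] [Field K] [NumberField K] [Algebra F K]
  [Field Fbar] [Algebra F Fbar] [Algebra K Fbar]
  {E : WeierstrassCurve F} [E.IsElliptic] {l : ℕ} {Pb : BadPlacePredicates K}
  (D : InitialThetaData F K Fbar E l Pb)
  (p : ℕ) [Fact p.Prime] (k : Type) [NontriviallyNormedField k] [CompleteSpace k] [IsUltrametricDist k]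
  [NormedAlgebra ℚ_[p] k] [FiniteDimensional ℚ_[p] k] [Algebra K k] (ι : Fbar →ₐ[K] AlgebraicClosure k)
  [IsScalarTower F K Fbar] [Normal K Fbar] (hX : IsOpen (D.PiXarrow : Set D.PiC))
  (β : Field.absoluteGaloisGroup k ≃ₜ* Field.absoluteGaloisGroup k)

/-- **[IUTchI] Cor 5.3 (iii) at the place record** `D.goodLocalFrobenioidOfEmb p k ι hX` (abc-iut-L5-t2; `Π_v̲ = Π_{X̲→_K} ×_{G_K} Gal(k̄/k)`): its `𝒞⊢_v̲ → 𝒟⊢_v̲`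
and `τ⊢_v̲` ARE those of §B (`ofKit_C`, `ofKit_tauDash`, rfl), so EVERY `β ∈ Aut(Gal(k̄/k))` lifts to a self-equivalence of `.Cdash` lying under `pullSelfEquiv β β⁻¹`
through `.CdashBase` and PRESERVING `.tauDash`. ([IUTchI] Cor 5.3 (iii) p.144) [claim: Mochizuki2012, status: disputed] -/
theorem exists_dashLift_ofEmb :
    letI := GaloisValDatum.normVal k
    ∃ Ψ : (D.goodLocalFrobenioidOfEmb p k ι hX).Cdash ≌ (D.goodLocalFrobenioidOfEmb p k ι hX).Cdash,
      Nonempty (CatIsomorphism.LiesUnder (D.goodLocalFrobenioidOfEmb p k ι hX).CdashBase (D.goodLocalFrobenioidOfEmb p k ι hX).CdashBase Ψ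
        (PiTransport.pullSelfEquiv _ _ β.continuous β.symm.continuous (toMonoidHom_comp_symm k β) (symm_comp_toMonoidHom k β))) ∧
      (D.goodLocalFrobenioidOfEmb p k ι hX).tauDash.IsPreservedBy (D.goodLocalFrobenioidOfEmb p k ι hX).tauDash Ψ.functor :=
  exists_dashLift p k β

/-- **The same in full at the place record**: EVERY self-equivalence of `(D.goodLocalFrobenioidOfEmb p k ι hX).Ddash` lifts to a `τ⊢`-preserving
self-equivalence of `.Cdash` lying under it through `.CdashBase`. ([IUTchI] Cor 5.3 (iii) p.144) [claim: Mochizuki2012, status: disputed] -/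
theorem exists_dashLift_ofEmb_of_equivalence
    (E : CosetCat (AlgebraicClosure k ≃ₐ[k] AlgebraicClosure k) ≌ CosetCat (AlgebraicClosure k ≃ₐ[k] AlgebraicClosure k)) :
    letI := GaloisValDatum.normVal k
    ∃ Ψ : (D.goodLocalFrobenioidOfEmb p k ι hX).Cdash ≌ (D.goodLocalFrobenioidOfEmb p k ι hX).Cdash,
      Nonempty (CatIsomorphism.LiesUnder (D.goodLocalFrobenioidOfEmb p k ι hX).CdashBase (D.goodLocalFrobenioidOfEmb p k ι hX).CdashBase Ψ E) ∧
      (D.goodLocalFrobenioidOfEmb p k ι hX).tauDash.IsPreservedBy (D.goodLocalFrobenioidOfEmb p k ι hX).tauDash Ψ.functor :=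
  exists_dashLift_of_equivalence p k E

end PlaceData

/-! ### §D. At the merge term: racer C's `frobeniusGoodAt` at every good nonarchimedean index -/

section AtTerm

variable {F K Fbar : Type} [Field F] [NumberField F] [Field K] [NumberField K] [Algebra F K]
  [Field Fbar] [Algebra F Fbar] [Algebra K Fbar]
  {E : WeierstrassCurve F} [E.IsElliptic] {l : ℕ} {Pb : BadPlacePredicates K}
  (D : InitialThetaData F K Fbar E l Pb) (CG : D.geom.pe.CuspGalois) (hA : D.geom.pe.ArrowCoveringClaims)
  (B : ∀ v, v ∈ D.indexCopyBad → D.BadPairAt v) (I : D.MergeInputs B) (x : D.IndexCopy) (hx : x ∉ D.indexCopyArc) [Fact (D.primeAt x hx).Prime]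
  (β : Field.absoluteGaloisGroup (D.KvAt x hx) ≃ₜ* Field.absoluteGaloisGroup (D.KvAt x hx))

/-- **[IUTchI] Cor 5.3 (iii), GOOD NONARCHIMEDEAN `⊢`-SLOT AT THE MERGE TERM.**  At every good nonarchimedean index `x` of the genuine `ℱ`-kit of record
(`GenuineFKitOfBadLocal`, abc-iut-L5-t2), the mono-analytic Frobenioid `(D.frobeniusGoodAt CG hA B I x hx).Cdash → 𝒟⊢_v̲ = CosetCat Gal(K̄_v̲/K_v̲)` admits,
for EVERY isomorphism of topological groups `β : Gal(K̄_v̲/K_v̲) ⥲ Gal(K̄_v̲/K_v̲)`, a self-equivalence lying under `pullSelfEquiv β β⁻¹` and preserving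
`τ⊢_v̲` — the surjectivity «`Isom(¹𝔉⊢, ²𝔉⊢) → Isom(¹𝔇⊢, ²𝔇⊢)` […] is surjective» of print onto the class of every `β`, under the kit's binders ∪ {`I`, `x`, `hx`}
only: LAW ∅ · FACT ∅. ([IUTchI] Cor 5.3 (iii) p.144) [claim: Mochizuki2012, status: disputed] -/
theorem exists_dashLift_frobeniusGoodAt :
    letI := GaloisValDatum.normVal (D.KvAt x hx)
    ∃ Ψ : (D.frobeniusGoodAt CG hA B I x hx).Cdash ≌ (D.frobeniusGoodAt CG hA B I x hx).Cdash,
      Nonempty (CatIsomorphism.LiesUnder (D.frobeniusGoodAt CG hA B I x hx).CdashBase (D.frobeniusGoodAt CG hA B I x hx).CdashBase Ψ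
        (PiTransport.pullSelfEquiv _ _ β.continuous β.symm.continuous (toMonoidHom_comp_symm (D.KvAt x hx) β)
          (symm_comp_toMonoidHom (D.KvAt x hx) β))) ∧
      (D.frobeniusGoodAt CG hA B I x hx).tauDash.IsPreservedBy (D.frobeniusGoodAt CG hA B I x hx).tauDash Ψ.functor := by
  haveI := D.isScalarTower
  haveI := D.normal_K
  letI := D.algebraKvAt x hx
  haveI := GaloisValDatum.finiteDimensional_rescaledCompletion K (D.primeAt x hx) (D.specAt x hx) (D.primeAt_mem x hx)
  exact exists_dashLift_ofEmb D (D.primeAt x hx) (D.KvAt x hx) (localEmb (K := K) (Fbar := Fbar) (AlgebraicClosure (D.KvAt x hx)))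
    (D.isOpen_PiXarrow_of_mergeInputs CG hA B I) β

/-- **[IUTchI] Cor 5.3 (iii), GOOD NONARCHIMEDEAN `⊢`-SLOT AT THE MERGE TERM, IN FULL**: at every good nonarchimedean index `x`, EVERY self-equivalence
`E` of `𝒟⊢_v̲ = (D.frobeniusGoodAt CG hA B I x hx).Ddash` (`= CosetCat Gal(K̄_v̲/K_v̲)`) lifts to a self-equivalence of `(…).Cdash` lying under `E` through
`(…).CdashBase` and preserving `(…).tauDash` — «`Isom(¹𝔉⊢, ²𝔉⊢) → Isom(¹𝔇⊢, ²𝔇⊢)` […] is surjective» at the genuine model, kit binders ∪ {`I`, `x`, `hx`} only: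
LAW ∅ · FACT ∅ · side ∅. ([IUTchI] Cor 5.3 (iii) p.144) [claim: Mochizuki2012, status: disputed] -/
theorem exists_dashLift_frobeniusGoodAt_of_equivalence
    (E : CosetCat (AlgebraicClosure (D.KvAt x hx) ≃ₐ[D.KvAt x hx] AlgebraicClosure (D.KvAt x hx)) ≌
      CosetCat (AlgebraicClosure (D.KvAt x hx) ≃ₐ[D.KvAt x hx] AlgebraicClosure (D.KvAt x hx))) :
    letI := GaloisValDatum.normVal (D.KvAt x hx)
    ∃ Ψ : (D.frobeniusGoodAt CG hA B I x hx).Cdash ≌ (D.frobeniusGoodAt CG hA B I x hx).Cdash,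
      Nonempty (CatIsomorphism.LiesUnder (D.frobeniusGoodAt CG hA B I x hx).CdashBase (D.frobeniusGoodAt CG hA B I x hx).CdashBase Ψ E) ∧
      (D.frobeniusGoodAt CG hA B I x hx).tauDash.IsPreservedBy (D.frobeniusGoodAt CG hA B I x hx).tauDash Ψ.functor := by
  haveI := D.isScalarTower
  haveI := D.normal_K
  letI := D.algebraKvAt x hx
  haveI := GaloisValDatum.finiteDimensional_rescaledCompletion K (D.primeAt x hx) (D.specAt x hx) (D.primeAt_mem x hx)
  exact exists_dashLift_ofEmb_of_equivalence D (D.primeAt x hx) (D.KvAt x hx) (localEmb (K := K) (Fbar := Fbar) (AlgebraicClosure (D.KvAt x hx)))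
    (D.isOpen_PiXarrow_of_mergeInputs CG hA B I) E

end AtTerm

/-! ### §E. `σ_α` preserves the spectral-norm valuation on ALL of `k̄ˣ` (v2 rider for the sibling slots: any constant section) -/
section ValuationRigid

variable (p : ℕ) [Fact p.Prime] (k : Type) [NontriviallyNormedField k] [CompleteSpace k] [IsUltrametricDist k]
  [NormedAlgebra ℚ_[p] k] [FiniteDimensional ℚ_[p] k]

/-- **`σ_α` PRESERVES THE VALUATION OF EVERY INTEGRAL `x ∈ k̄ˣ`** (the argument of `valuation_sigma_eq_of_coe_eq_p` for an arbitrary absolute integer: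
`x^m = π^n · u` by abc-iut-L6-t13 `isAbsInteger_iff_exists_pow_eq`, `σ_α(x)^m = π'^n · σ_α(u)`). [cite: MochizukiAbsAnab2004, Prop 1.2.1 (iv) p.10] -/
theorem valuation_sigma_eq_of_le_one (α : Field.absoluteGaloisGroup k ≃ₜ* Field.absoluteGaloisGroup k) (x : (AlgebraicClosure k)ˣ)
    (hx : @ValuativeRel.valuation (AlgebraicClosure k) _ (GaloisValDatum.ofComplete p k).valΩ (x : AlgebraicClosure k) ≤ 1) :
    letI := GaloisValDatum.normVal k
    haveI := GoodPlaceSigma.isNonarchimedeanLocalField p k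
    haveI : CharZero k := GaloisValDatum.charZero p k
    @ValuativeRel.valuation (AlgebraicClosure k) _ (GaloisValDatum.ofComplete p k).valΩ (MLFSigma.sigma k α x : AlgebraicClosure k) =
      @ValuativeRel.valuation (AlgebraicClosure k) _ (GaloisValDatum.ofComplete p k).valΩ (x : AlgebraicClosure k) := by
  letI := GaloisValDatum.normVal k
  haveI := GoodPlaceSigma.isNonarchimedeanLocalField p k
  haveI : CharZero k := GaloisValDatum.charZero p k
  letI : ValuativeRel (AlgebraicClosure k) := (GaloisValDatum.ofComplete p k).valΩ
  haveI : ValuativeExtension k (AlgebraicClosure k) := (GaloisValDatum.ofComplete p k).valExt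
  obtain ⟨π, hπ⟩ := exists_isUniformizer k
  obtain ⟨π₂, hπ₂, hσπ⟩ := MLFSigma.preservesUniformizers_sigma k α π hπ
  have hU := MLFSigma.preservesAbsUnits_sigma k α
  have hxint : (x : AlgebraicClosure k) ∈ absIntegers 𝒪[k] k := (valuation_closure_le_one_iff_mem_absIntegers p k (x : AlgebraicClosure k)).mp hx
  obtain ⟨m, n, hm, u, hu, hxu⟩ := (Prop121vii.isAbsInteger_iff_exists_pow_eq k π hπ x).mp hxint
  have hσxu : MLFSigma.sigma k α x ^ m =
      Units.map (algebraMap k (AlgebraicClosure k) : k →* AlgebraicClosure k) π₂ ^ n * MLFSigma.sigma k α u := by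
    rw [← map_pow, hxu, map_mul, map_pow, hσπ]
  have hvπ : ValuativeRel.valuation (AlgebraicClosure k) ((Units.map (algebraMap k (AlgebraicClosure k) : k →* AlgebraicClosure k) π₂ : (AlgebraicClosure k)ˣ) : AlgebraicClosure k) =
      ValuativeRel.valuation (AlgebraicClosure k) ((Units.map (algebraMap k (AlgebraicClosure k) : k →* AlgebraicClosure k) π : (AlgebraicClosure k)ˣ) : AlgebraicClosure k) := by
    have e : ValuativeRel.valuation k (π₂ : k) = ValuativeRel.valuation k (π : k) := hπ₂.trans hπ.symm
    rw [Units.coe_map, Units.coe_map, MonoidHom.coe_coe, le_antisymm_iff, ← Valuation.Compatible.vle_iff_le, ← Valuation.Compatible.vle_iff_le,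
      ValuativeExtension.vle_iff_vle, ValuativeExtension.vle_iff_vle, Valuation.Compatible.vle_iff_le (v := ValuativeRel.valuation k),
      Valuation.Compatible.vle_iff_le (v := ValuativeRel.valuation k), ← le_antisymm_iff, e]
  have hvu : ValuativeRel.valuation (AlgebraicClosure k) (u : AlgebraicClosure k) = 1 := valuation_eq_one_of_absUnit p k u hu
  have hvσu : ValuativeRel.valuation (AlgebraicClosure k) (MLFSigma.sigma k α u : AlgebraicClosure k) = 1 :=
    valuation_eq_one_of_absUnit p k _ ((hU u).mp hu)
  have h1 : ValuativeRel.valuation (AlgebraicClosure k) (MLFSigma.sigma k α x : AlgebraicClosure k) ^ m =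
      ValuativeRel.valuation (AlgebraicClosure k) ((Units.map (algebraMap k (AlgebraicClosure k) : k →* AlgebraicClosure k) π : (AlgebraicClosure k)ˣ) : AlgebraicClosure k) ^ n := by
    rw [← map_pow, ← Units.val_pow_eq_pow_val, hσxu, Units.val_mul, Units.val_pow_eq_pow_val, map_mul, map_pow, hvσu, mul_one, hvπ]
  have h2 : ValuativeRel.valuation (AlgebraicClosure k) (x : AlgebraicClosure k) ^ m =
      ValuativeRel.valuation (AlgebraicClosure k) ((Units.map (algebraMap k (AlgebraicClosure k) : k →* AlgebraicClosure k) π : (AlgebraicClosure k)ˣ) : AlgebraicClosure k) ^ n := by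
    rw [← map_pow, ← Units.val_pow_eq_pow_val, hxu, Units.val_mul, Units.val_pow_eq_pow_val, map_mul, map_pow, hvu, mul_one]
  exact (pow_left_inj₀ zero_le zero_le hm.ne').mp (h1.trans h2.symm)

/-- **`σ_α` PRESERVES THE SPECTRAL-NORM VALUATION ON ALL OF `k̄ˣ`** (the integral case for `x` or for `x⁻¹`): the anabelian units transport is an
automorphism of the VALUED group `k̄ˣ` — OUR corollary of the tree's L02 clauses. [cite: MochizukiAbsAnab2004, Prop 1.2.1 (iv) p.10] -/
theorem valuation_sigma_eq (α : Field.absoluteGaloisGroup k ≃ₜ* Field.absoluteGaloisGroup k) (x : (AlgebraicClosure k)ˣ) :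
    letI := GaloisValDatum.normVal k
    haveI := GoodPlaceSigma.isNonarchimedeanLocalField p k
    haveI : CharZero k := GaloisValDatum.charZero p k
    @ValuativeRel.valuation (AlgebraicClosure k) _ (GaloisValDatum.ofComplete p k).valΩ (MLFSigma.sigma k α x : AlgebraicClosure k) =
      @ValuativeRel.valuation (AlgebraicClosure k) _ (GaloisValDatum.ofComplete p k).valΩ (x : AlgebraicClosure k) := by
  letI := GaloisValDatum.normVal k
  haveI := GoodPlaceSigma.isNonarchimedeanLocalField p k
  haveI : CharZero k := GaloisValDatum.charZero p k
  letI : ValuativeRel (AlgebraicClosure k) := (GaloisValDatum.ofComplete p k).valΩ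
  by_cases hx : ValuativeRel.valuation (AlgebraicClosure k) (x : AlgebraicClosure k) ≤ 1
  · exact valuation_sigma_eq_of_le_one p k α x hx
  · have hx' : ValuativeRel.valuation (AlgebraicClosure k) ((x⁻¹ : (AlgebraicClosure k)ˣ) : AlgebraicClosure k) ≤ 1 := by
      rw [Units.val_inv_eq_inv_val, map_inv₀]
      exact inv_le_one_of_one_le₀ (le_of_not_ge hx)
    have h := valuation_sigma_eq_of_le_one p k α x⁻¹ hx'
    rwa [map_inv, Units.val_inv_eq_inv_val, Units.val_inv_eq_inv_val, map_inv₀, map_inv₀, inv_inj] at h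

end ValuationRigid
end Cor53iii

end Literature.IUT.HodgeTheaters

end
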